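import Summits.SmoothPoincare4.SmoothPoincare4.Theorems.CylinderEntropyCylinderRungTwoHeatSmoothingContDiff
import Summits.SmoothPoincare4.SmoothPoincare4.Theorems.CylinderEntropyCylinderRungTwoHeatSmoothingTimeDeriv
import Summits.SmoothPoincare4.SmoothPoincare4.Theorems.CylinderEntropyCylinderRungTwoHeatSmoothingLargeTime
import Summits.SmoothPoincare4.SmoothPoincare4.Theorems.CylinderEntropyCylinderRungTwoGraphicalIsSphere
import Literature.Geometry.Riemannian.SphericalCylinderEntropy
import Mathlib.Analysis.Calculus.ParametricIntegral
import Mathlib.Analysis.Calculus.MeanValue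
import Mathlib.MeasureTheory.Integral.Prod
import HarnessLib

/-!
# Route `CylinderEntropy`, crux `CylinderRungTwo` (stmt-SmoothPoincare4-7631), line `killing-flux`:
# `S⁴`-equidistribution per height, part 1 — the heat-flow pairing is constant
# (registered sub-goal `helper_equidistribution_part1` of helper `helper_equidistribution`, step S4
# of the area-quantization plan)

Let `μ` be a finite Borel measure on `ℝ⁶` carried by the slab `{z ∈ N | |z₅| ≤ B}` of the round
cylinder `N = S⁴ × ℝ = {∑_{i<5} zᵢ² = 1}`, and suppose that `μ` annihilates the height-weighted
Laplace–Beltrami operator of `S⁴`: for all `Φ ∈ C²(ℝ)` and `P ∈ C²(ℝ⁵)`,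

  `∫ Φ(z₅) [Δ_{ℝ⁵} P(z') - D²P(z')(z', z') - 4 DP(z')(z')] dμ(z) = 0`,  `z' = truncL z`

(for `|z'| = 1` the bracket is `Δ_{S⁴}(P|_{S⁴})(z')`).  For `Φ ∈ C²(ℝ)` and continuous
`g : ℝ⁵ → ℝ` let `T_t g(w) = ∫_{S⁴} 𝔥(t, ⟨w, y⟩) g(y) dμH⁴(y)` be the zonal heat smoothing
(`𝔥 = zonal`, the tree's typed zonal heat kernel of `S⁴`) and

  `F(t) = ∫ Φ(z₅) T_t g(z') dμ(z)`,  `t > 0`.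

Then **`F` is constant on `(0, ∞)`**:
* `F` is differentiable with `F'(t) = ∫ Φ(z₅) ∂_t T_t g(z') dμ` (differentiation under the
  `μ`-integral, `hasDerivAt_integral_of_dominated_loc_of_deriv_le`: the pointwise time derivative is
  the landed `helper_heatSmoothingTimeDeriv`; on `t' > t/2` the derivative
  `∫_{S⁴} ((1 - s²) 𝔥'' - 4 s 𝔥') g` is dominated through the landed `abs_heat_zonal_le`
  (`|s| ≤ 1` since `z' ∈ S⁴` on the carrier) and `sup_{S⁴} |g|`, `sup_{[-B,B]} |Φ|`);
* `∂_t T_t g(w) = ∫_{S⁴} ((1 - s²) 𝔥'' - 4 s 𝔥') g` IS the bracket of `P = T_t g ∈ C^∞(ℝ⁵)` at `w`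
  (landed `zonalSmoothing_bracket`, `contDiff_zonalSmoothing`), so `F'(t) = 0` by the hypothesis,
  and `F(t₁) = F(t₂)` for `t₁, t₂ > 0` (`IsOpen.is_const_of_deriv_eq_zero` on `(0, ∞)`).

Also recorded here, for part 2 (the limits `t → 0⁺`, `t → ∞` and the Weierstrass step): the carrier
in a.e. form, integrability of `Φ(z₅) u(z')` for continuous `Φ`, `u`, and the two elementary
`sup × mass` estimates for differences of such integrals.

* `Equidistribution.ae_carrier` — the carrier in a.e. form (with the landed `truncL_mem_sphere` of
  `…GraphicalIsSphere`: `z' ∈ S⁴` on the cylinder);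
* `Equidistribution.integrable_mul_truncL`, `abs_integral_mul_sub_mul_le`,
  `abs_integral_sub_integral_le` — integral estimates on `μ`;
* `Equidistribution.hasDerivAt_flow`, `Equidistribution.flow_eq_flow` — `F'` and the constancy;
* `helper_equidistribution_part1` — the registered sub-goal (the constancy), verbatim.

Everything here is PROVED (no `sorry`, no new definitions, no named facts).

References: E. B. Davies, *Heat kernels and spectral theory* (1989), Ch. 5 (heat semigroup on a
compact manifold); J. Dieudonné, *Foundations of Modern Analysis* (1960), (8.11.2)
(differentiation under the integral sign).
-/

-- the prescribed namespace `Summit.SmoothPoincare4.SmoothPoincare4.…` repeats `SmoothPoincare4`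
set_option linter.dupNamespace false

noncomputable section

open MeasureTheory Set Filter
open scoped Manifold ContDiff ENNReal NNReal Topology BigOperators

namespace Summit.SmoothPoincare4.SmoothPoincare4.Cruxes.CylinderRungTwo.KillingFlux

open Literature.Geometry.Riemannian
open Literature.Geometry.Riemannian.SphericalCylinderEntropy (truncL zonal contDiff_zonal
  hausdorffMeasure_sphere_four_lt_top)
open HeatSmoothingContDiff HeatSmoothingLargeTime
-- the landed `truncL_mem_sphere` (`‖z'‖ = 1` on the cylinder) of the sibling `…GraphicalIsSphere`
open Summit.SmoothPoincare4.SmoothPoincare4.Theorems.CylinderRungTwo.KillingFlux (truncL_mem_sphere)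

namespace Equidistribution

/-! ### The carrier `{z ∈ N | |z₅| ≤ B}` -/

/-- The carrier hypothesis in almost-everywhere form. [folklore] -/
theorem ae_carrier {B : ℝ} {μ : Measure (EuclideanSpace ℝ (Fin 6))}
    (hsupp : μ {z : EuclideanSpace ℝ (Fin 6) |
      ¬ (∑ i : Fin 5, z (Fin.castSucc i) ^ 2 = 1 ∧ |z 5| ≤ B)} = 0) :
    ∀ᵐ z ∂μ, ∑ i : Fin 5, z (Fin.castSucc i) ^ 2 = 1 ∧ |z 5| ≤ B :=
  ae_iff.2 hsupp

/-- The height coordinate is continuous. [folklore] -/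
theorem continuous_apply_five : Continuous fun z : EuclideanSpace ℝ (Fin 6) => z 5 := by
  fun_prop

/-! ### Integral estimates on the finite measure `μ` -/

/-- `z ↦ Φ(z₅) u(z')` is `μ`-integrable for continuous `Φ`, `u` (bounded on the compact carrier).
[folklore] -/
theorem integrable_mul_truncL {B : ℝ} (μ : Measure (EuclideanSpace ℝ (Fin 6))) [IsFiniteMeasure μ]
    (hsupp : μ {z : EuclideanSpace ℝ (Fin 6) |
      ¬ (∑ i : Fin 5, z (Fin.castSucc i) ^ 2 = 1 ∧ |z 5| ≤ B)} = 0)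
    {Φ : ℝ → ℝ} (hΦ : Continuous Φ) {u : EuclideanSpace ℝ (Fin 5) → ℝ} (hu : Continuous u) :
    Integrable (fun z => Φ (z 5) * u (truncL z)) μ := by
  obtain ⟨A, hA⟩ := (isCompact_Icc (a := -B) (b := B)).exists_bound_of_continuousOn hΦ.continuousOn
  obtain ⟨U, hU⟩ :=
    (isCompact_sphere (0 : EuclideanSpace ℝ (Fin 5)) 1).exists_bound_of_continuousOn hu.continuousOn
  refine Integrable.of_bound
    ((hΦ.comp continuous_apply_five).mul (hu.comp truncL.continuous)).aestronglyMeasurable (A * U)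
    ((ae_carrier hsupp).mono fun z hz => ?_)
  rw [norm_mul]
  have h1 := hA (z 5) (mem_Icc.2 (abs_le.1 hz.2))
  exact mul_le_mul h1 (hU _ (truncL_mem_sphere hz.1)) (norm_nonneg _) ((norm_nonneg _).trans h1)

/-- Difference of two `μ`-integrals under an a.e. bound of the integrands. [folklore] -/
theorem abs_integral_sub_le_of_ae (μ : Measure (EuclideanSpace ℝ (Fin 6))) [IsFiniteMeasure μ]
    {f₁ f₂ : EuclideanSpace ℝ (Fin 6) → ℝ} (h₁ : Integrable f₁ μ) (h₂ : Integrable f₂ μ) {C : ℝ}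
    (hC : ∀ᵐ z ∂μ, |f₁ z - f₂ z| ≤ C) :
    |(∫ z, f₁ z ∂μ) - ∫ z, f₂ z ∂μ| ≤ C * μ.real univ := by
  rw [← integral_sub h₁ h₂, ← Real.norm_eq_abs]
  exact norm_integral_le_of_norm_le_const (hC.mono fun z hz => by rwa [Real.norm_eq_abs])

/-- Same height weight, two sphere factors `ε`-close on `S⁴`:
`|∫ Φ(z₅) u(z') dμ - ∫ Φ(z₅) v(z') dμ| ≤ A ε μ(ℝ⁶)` if `|Φ| ≤ A` on `[-B, B]`. [folklore] -/
theorem abs_integral_mul_sub_mul_le {B : ℝ} (μ : Measure (EuclideanSpace ℝ (Fin 6)))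
    [IsFiniteMeasure μ]
    (hsupp : μ {z : EuclideanSpace ℝ (Fin 6) |
      ¬ (∑ i : Fin 5, z (Fin.castSucc i) ^ 2 = 1 ∧ |z 5| ≤ B)} = 0)
    {Φ : ℝ → ℝ} (hΦ : Continuous Φ) {A : ℝ} (hA : ∀ s ∈ Icc (-B) B, |Φ s| ≤ A)
    {u v : EuclideanSpace ℝ (Fin 5) → ℝ} (hu : Continuous u) (hv : Continuous v) {ε : ℝ}
    (huv : ∀ w ∈ Metric.sphere (0 : EuclideanSpace ℝ (Fin 5)) 1, |u w - v w| ≤ ε) :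
    |(∫ z, Φ (z 5) * u (truncL z) ∂μ) - ∫ z, Φ (z 5) * v (truncL z) ∂μ| ≤ A * ε * μ.real univ := by
  refine abs_integral_sub_le_of_ae μ (integrable_mul_truncL μ hsupp hΦ hu)
    (integrable_mul_truncL μ hsupp hΦ hv) ((ae_carrier hsupp).mono fun z hz => ?_)
  rw [← mul_sub, abs_mul]
  have h1 := hA (z 5) (mem_Icc.2 (abs_le.1 hz.2))
  exact mul_le_mul h1 (huv _ (truncL_mem_sphere hz.1)) (abs_nonneg _) ((abs_nonneg _).trans h1)

/-- Same sphere factor, two height weights `ε`-close on `[-B, B]`: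
`|∫ Φ₁(z₅) u(z') dμ - ∫ Φ₂(z₅) u(z') dμ| ≤ ε U μ(ℝ⁶)` if `|u| ≤ U` on `S⁴`. [folklore] -/
theorem abs_integral_sub_integral_le {B : ℝ} (μ : Measure (EuclideanSpace ℝ (Fin 6)))
    [IsFiniteMeasure μ]
    (hsupp : μ {z : EuclideanSpace ℝ (Fin 6) |
      ¬ (∑ i : Fin 5, z (Fin.castSucc i) ^ 2 = 1 ∧ |z 5| ≤ B)} = 0)
    {Φ₁ Φ₂ : ℝ → ℝ} (hΦ₁ : Continuous Φ₁) (hΦ₂ : Continuous Φ₂) {ε : ℝ}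
    (h12 : ∀ s ∈ Icc (-B) B, |Φ₁ s - Φ₂ s| ≤ ε)
    {u : EuclideanSpace ℝ (Fin 5) → ℝ} (hu : Continuous u) {U : ℝ}
    (hU : ∀ w ∈ Metric.sphere (0 : EuclideanSpace ℝ (Fin 5)) 1, |u w| ≤ U) :
    |(∫ z, Φ₁ (z 5) * u (truncL z) ∂μ) - ∫ z, Φ₂ (z 5) * u (truncL z) ∂μ| ≤ ε * U * μ.real univ := by
  refine abs_integral_sub_le_of_ae μ (integrable_mul_truncL μ hsupp hΦ₁ hu)
    (integrable_mul_truncL μ hsupp hΦ₂ hu) ((ae_carrier hsupp).mono fun z hz => ?_)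
  rw [← sub_mul, abs_mul]
  have h1 := h12 (z 5) (mem_Icc.2 (abs_le.1 hz.2))
  exact mul_le_mul h1 (hU _ (truncL_mem_sphere hz.1)) (abs_nonneg _) ((abs_nonneg _).trans h1)

/-- A real number estimate: `|a - b| ≤ K ε` for all `ε > 0` forces `a = b`. [folklore] -/
theorem eq_of_abs_sub_le_mul {a b K : ℝ} (hK : 0 ≤ K) (h : ∀ ε : ℝ, 0 < ε → |a - b| ≤ K * ε) :
    a = b := by
  refine eq_of_forall_dist_le fun ε hε => ?_
  rw [Real.dist_eq]
  have hK1 : 0 < K + 1 := by linarith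
  calc |a - b| ≤ K * (ε / (K + 1)) := h _ (div_pos hε hK1)
    _ ≤ (K + 1) * (ε / (K + 1)) := by gcongr; linarith
    _ = ε := mul_div_cancel₀ ε hK1.ne'

/-! ### The heat-flow pairing `F(t) = ∫ Φ(z₅) T_t g(z') dμ` -/

/-- Sup bound for integrals over `S⁴`: `|∫_{S⁴} f| ≤ C μH⁴(S⁴)` if `|f| ≤ C` on `S⁴`. [folklore] -/
theorem abs_setIntegral_sphere_le {f : EuclideanSpace ℝ (Fin 5) → ℝ} {C : ℝ}
    (hC : ∀ y ∈ Metric.sphere (0 : EuclideanSpace ℝ (Fin 5)) 1, |f y| ≤ C) :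
    |∫ y in Metric.sphere (0 : EuclideanSpace ℝ (Fin 5)) 1, f y ∂μH[4]| ≤
      C * (μH[4] : Measure (EuclideanSpace ℝ (Fin 5))).real
        (Metric.sphere (0 : EuclideanSpace ℝ (Fin 5)) 1) := by
  rw [← Real.norm_eq_abs]
  exact norm_setIntegral_le_of_norm_le_const hausdorffMeasure_sphere_four_lt_top fun y hy => by
    rw [Real.norm_eq_abs]
    exact hC y hy

/-- **`F` is differentiable, with `F'(t) = ∫ Φ(z₅) ∂_t T_t g(z') dμ`** (differentiation under the
`μ`-integral: pointwise `helper_heatSmoothingTimeDeriv`; on `t' > t/2` the time derivative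
`∫_{S⁴} ((1 - s²) 𝔥'' - 4 s 𝔥') g` is bounded by `abs_heat_zonal_le` (`|s| ≤ 1` for `z' ∈ S⁴`) times
`sup |g|`, and `|Φ(z₅)| ≤ sup_{[-B,B]} |Φ|` on the carrier). [folklore] -/
theorem hasDerivAt_flow {B : ℝ} (μ : Measure (EuclideanSpace ℝ (Fin 6))) [IsFiniteMeasure μ]
    (hsupp : μ {z : EuclideanSpace ℝ (Fin 6) |
      ¬ (∑ i : Fin 5, z (Fin.castSucc i) ^ 2 = 1 ∧ |z 5| ≤ B)} = 0)
    {Φ : ℝ → ℝ} (hΦ : Continuous Φ) {g : EuclideanSpace ℝ (Fin 5) → ℝ} (hg : Continuous g)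
    {t : ℝ} (ht : 0 < t) :
    HasDerivAt (fun t' : ℝ => ∫ z, Φ (z 5) *
        (∫ y in Metric.sphere (0 : EuclideanSpace ℝ (Fin 5)) 1,
          zonal t' (∑ i : Fin 5, truncL z i * y i) * g y ∂μH[4]) ∂μ)
      (∫ z, Φ (z 5) *
        (∫ y in Metric.sphere (0 : EuclideanSpace ℝ (Fin 5)) 1,
          ((1 - (∑ i : Fin 5, truncL z i * y i) ^ 2) *
              deriv (deriv (zonal t)) (∑ i : Fin 5, truncL z i * y i) -
            4 * (∑ i : Fin 5, truncL z i * y i) *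
              deriv (zonal t) (∑ i : Fin 5, truncL z i * y i)) * g y ∂μH[4]) ∂μ) t := by
  have hK := ae_carrier hsupp
  -- bounds: `Φ` on `[-B, B]`, `g` and `T_t g` on the sphere, the heat operator of the kernel
  obtain ⟨A, hA⟩ := (isCompact_Icc (a := -B) (b := B)).exists_bound_of_continuousOn hΦ.continuousOn
  obtain ⟨G, hG⟩ :=
    (isCompact_sphere (0 : EuclideanSpace ℝ (Fin 5)) 1).exists_bound_of_continuousOn hg.continuousOn
  have hQc : ∀ {x : ℝ}, 0 < x → Continuous fun w : EuclideanSpace ℝ (Fin 5) =>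
      ∫ y in Metric.sphere (0 : EuclideanSpace ℝ (Fin 5)) 1, zonal x (∑ i : Fin 5, w i * y i) * g y
        ∂μH[4] := fun hx => (contDiff_zonalSmoothing hx hg).continuous
  obtain ⟨C, hC0, hCb⟩ : ∃ C : ℝ, 0 ≤ C ∧ ∀ x : ℝ, t / 2 < x → ∀ σ : ℝ, |σ| ≤ 1 →
      |(1 - σ ^ 2) * deriv (deriv (zonal x)) σ - 4 * σ * deriv (zonal x) σ| ≤ C :=
    ⟨_, tsum_nonneg fun k => by positivity, fun x hx σ hσ => abs_heat_zonal_le ht le_rfl hx hσ⟩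
  -- the heat operator applied to the kernel is jointly continuous, hence its smoothing is measurable
  have hd1 : ∀ {x : ℝ}, 0 < x → Continuous (deriv (zonal x)) := fun hx =>
    (contDiff_infty_iff_deriv.1 (contDiff_zonal hx)).2.continuous
  have hd2 : ∀ {x : ℝ}, 0 < x → Continuous (deriv (deriv (zonal x))) := fun hx =>
    (contDiff_infty_iff_deriv.1 (contDiff_infty_iff_deriv.1 (contDiff_zonal hx)).2).2.continuous
  have hDm : StronglyMeasurable fun w : EuclideanSpace ℝ (Fin 5) =>
      ∫ y in Metric.sphere (0 : EuclideanSpace ℝ (Fin 5)) 1,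
        ((1 - (∑ i : Fin 5, w i * y i) ^ 2) * deriv (deriv (zonal t)) (∑ i : Fin 5, w i * y i) -
          4 * (∑ i : Fin 5, w i * y i) * deriv (zonal t) (∑ i : Fin 5, w i * y i)) * g y ∂μH[4] := by
    haveI : IsFiniteMeasure ((μH[4] : Measure (EuclideanSpace ℝ (Fin 5))).restrict
        (Metric.sphere (0 : EuclideanSpace ℝ (Fin 5)) 1)) :=
      isFiniteMeasure_restrict.2 hausdorffMeasure_sphere_four_lt_top.ne
    refine StronglyMeasurable.integral_prod_right
      (f := fun (w y : EuclideanSpace ℝ (Fin 5)) =>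
        ((1 - (∑ i : Fin 5, w i * y i) ^ 2) * deriv (deriv (zonal t)) (∑ i : Fin 5, w i * y i) -
          4 * (∑ i : Fin 5, w i * y i) * deriv (zonal t) (∑ i : Fin 5, w i * y i)) * g y) ?_
    have hs : Continuous fun p : EuclideanSpace ℝ (Fin 5) × EuclideanSpace ℝ (Fin 5) =>
        ∑ i : Fin 5, p.1 i * p.2 i := by fun_prop
    exact ((((continuous_const.sub (hs.pow 2)).mul ((hd2 ht).comp hs)).sub
      ((continuous_const.mul hs).mul ((hd1 ht).comp hs))).mul
        (hg.comp continuous_snd)).stronglyMeasurable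
  obtain ⟨Mq, hMq⟩ :=
    (isCompact_sphere (0 : EuclideanSpace ℝ (Fin 5)) 1).exists_bound_of_continuousOn
      (hQc ht).continuousOn
  refine (hasDerivAt_integral_of_dominated_loc_of_deriv_le (μ := μ)
    (F := fun (x : ℝ) (z : EuclideanSpace ℝ (Fin 6)) => Φ (z 5) *
      ∫ y in Metric.sphere (0 : EuclideanSpace ℝ (Fin 5)) 1,
        zonal x (∑ i : Fin 5, truncL z i * y i) * g y ∂μH[4])
    (F' := fun (x : ℝ) (z : EuclideanSpace ℝ (Fin 6)) => Φ (z 5) *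
      ∫ y in Metric.sphere (0 : EuclideanSpace ℝ (Fin 5)) 1,
        ((1 - (∑ i : Fin 5, truncL z i * y i) ^ 2) *
            deriv (deriv (zonal x)) (∑ i : Fin 5, truncL z i * y i) -
          4 * (∑ i : Fin 5, truncL z i * y i) *
            deriv (zonal x) (∑ i : Fin 5, truncL z i * y i)) * g y ∂μH[4])
    (x₀ := t) (s := Set.Ioi (t / 2))
    (bound := fun _ => A * (C * G * (μH[4] : Measure (EuclideanSpace ℝ (Fin 5))).real
      (Metric.sphere (0 : EuclideanSpace ℝ (Fin 5)) 1)))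
    (Ioi_mem_nhds (by linarith)) ?_ ?_ ?_ ?_ ?_ ?_).2
  · -- measurability of `F x` for `x` near `t`
    filter_upwards [Ioi_mem_nhds ht] with x hx
    exact ((hΦ.comp continuous_apply_five).mul
      ((hQc hx).comp truncL.continuous)).aestronglyMeasurable
  · -- integrability of `F t`
    refine Integrable.of_bound ((hΦ.comp continuous_apply_five).mul
      ((hQc ht).comp truncL.continuous)).aestronglyMeasurable (A * Mq) (hK.mono fun z hz => ?_)
    rw [norm_mul]
    have h1 := hA (z 5) (mem_Icc.2 (abs_le.1 hz.2))
    exact mul_le_mul h1 (hMq _ (truncL_mem_sphere hz.1)) (norm_nonneg _) ((norm_nonneg _).trans h1)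
  · -- measurability of `F' t`
    exact (hΦ.comp continuous_apply_five).aestronglyMeasurable.mul
      (hDm.measurable.comp truncL.continuous.measurable).aestronglyMeasurable
  · -- the uniform bound on `t' > t/2`, on the carrier
    refine hK.mono fun z hz x hx => ?_
    have h1 := hA (z 5) (mem_Icc.2 (abs_le.1 hz.2))
    have hw1 : ‖truncL z‖ ≤ 1 := (mem_sphere_zero_iff_norm.1 (truncL_mem_sphere hz.1)).le
    rw [norm_mul, Real.norm_eq_abs (∫ y in _, _ ∂_)]
    refine mul_le_mul h1 (abs_setIntegral_sphere_le fun y hy => ?_) (abs_nonneg _)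
      ((norm_nonneg _).trans h1)
    rw [abs_mul]
    have hgy : |g y| ≤ G := by simpa only [Real.norm_eq_abs] using hG y hy
    exact mul_le_mul (hCb x hx _ (abs_sum_mul_le_one hw1 hy)) hgy (abs_nonneg _) hC0
  · exact integrable_const _
  · -- the pointwise time derivative
    refine Filter.Eventually.of_forall fun z x hx => ?_
    have hx0 : 0 < x := by linarith [Set.mem_Ioi.1 hx]
    exact (helper_heatSmoothingTimeDeriv g hg (truncL z) x hx0).const_mul (Φ (z 5))

/-- **`F` is constant on `(0, ∞)`**: its derivative `∫ Φ(z₅) ∂_t T_t g(z') dμ` is the hypothesis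
applied to `P = T_t g ∈ C²(ℝ⁵)` (`contDiff_zonalSmoothing`), because `∂_t T_t g(w)` is the bracket
`∑_j D²P(w)(eⱼ,eⱼ) - D²P(w)(w,w) - 4 DP(w)(w)` (`zonalSmoothing_bracket`). [folklore] -/
theorem flow_eq_flow {B : ℝ} (μ : Measure (EuclideanSpace ℝ (Fin 6))) [IsFiniteMeasure μ]
    (hsupp : μ {z : EuclideanSpace ℝ (Fin 6) |
      ¬ (∑ i : Fin 5, z (Fin.castSucc i) ^ 2 = 1 ∧ |z 5| ≤ B)} = 0)
    (hH : ∀ Φ : ℝ → ℝ, ContDiff ℝ 2 Φ → ∀ P : EuclideanSpace ℝ (Fin 5) → ℝ, ContDiff ℝ 2 P →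
      ∫ z, Φ (z 5) *
        ((∑ j : Fin 5, iteratedFDeriv ℝ 2 P (truncL z)
            ![EuclideanSpace.single j (1 : ℝ), EuclideanSpace.single j (1 : ℝ)])
          - iteratedFDeriv ℝ 2 P (truncL z) ![truncL z, truncL z]
          - 4 * fderiv ℝ P (truncL z) (truncL z)) ∂μ = 0)
    {Φ : ℝ → ℝ} (hΦ : ContDiff ℝ 2 Φ) {g : EuclideanSpace ℝ (Fin 5) → ℝ} (hg : Continuous g)
    {t₁ t₂ : ℝ} (h₁ : 0 < t₁) (h₂ : 0 < t₂) :
    (∫ z, Φ (z 5) * (∫ y in Metric.sphere (0 : EuclideanSpace ℝ (Fin 5)) 1,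
        zonal t₁ (∑ i : Fin 5, truncL z i * y i) * g y ∂μH[4]) ∂μ) =
      ∫ z, Φ (z 5) * (∫ y in Metric.sphere (0 : EuclideanSpace ℝ (Fin 5)) 1,
        zonal t₂ (∑ i : Fin 5, truncL z i * y i) * g y ∂μH[4]) ∂μ := by
  -- the derivative vanishes at every `t > 0`
  have hd : ∀ t ∈ Set.Ioi (0 : ℝ), HasDerivAt (fun t' : ℝ => ∫ z, Φ (z 5) *
      (∫ y in Metric.sphere (0 : EuclideanSpace ℝ (Fin 5)) 1,
        zonal t' (∑ i : Fin 5, truncL z i * y i) * g y ∂μH[4]) ∂μ) 0 t := by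
    intro t ht
    have h := hasDerivAt_flow μ hsupp hΦ.continuous hg (Set.mem_Ioi.1 ht)
    have h0 := hH Φ hΦ _ (contDiff_infty.1 (contDiff_zonalSmoothing (Set.mem_Ioi.1 ht) hg) 2)
    simp only [zonalSmoothing_bracket (Set.mem_Ioi.1 ht) hg] at h0
    rwa [h0] at h
  exact isOpen_Ioi.is_const_of_deriv_eq_zero isPreconnected_Ioi
    (fun t ht => (hd t ht).differentiableAt.differentiableWithinAt) (fun t ht => (hd t ht).deriv)
    h₁ h₂

end Equidistribution

open Equidistribution

/-- **Registered sub-goal `helper_equidistribution_part1` of helper `helper_equidistribution` (line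
`killing-flux`, step S4 of the area-quantization plan): the heat-flow pairing is constant.** For a
finite measure `μ` on `ℝ⁶` carried by the slab `{z ∈ N | |z₅| ≤ B}` and annihilating
`Φ(z₅) [Δ P - D²P(z',z') - 4 DP(z')](z')` for all `Φ ∈ C²(ℝ)`, `P ∈ C²(ℝ⁵)`, and for `Φ ∈ C²(ℝ)`,
continuous `g : ℝ⁵ → ℝ` and `t₁, t₂ > 0`:
`∫ Φ(z₅) T_{t₁} g(z') dμ = ∫ Φ(z₅) T_{t₂} g(z') dμ`, `T_t g(w) = ∫_{S⁴} 𝔥(t, ⟨w, y⟩) g(y) dμH⁴(y)`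
(`Equidistribution.flow_eq_flow`). [folklore] -/
theorem helper_equidistribution_part1 : ∀ (B : ℝ) (μ : Measure (EuclideanSpace ℝ (Fin 6))) [IsFiniteMeasure μ], μ {z : EuclideanSpace ℝ (Fin 6) | ¬ (∑ i : Fin 5, z (Fin.castSucc i) ^ 2 = 1 ∧ |z 5| ≤ B)} = 0 → (∀ Φ : ℝ → ℝ, ContDiff ℝ 2 Φ → ∀ P : EuclideanSpace ℝ (Fin 5) → ℝ, ContDiff ℝ 2 P → ∫ z, Φ (z 5) * ((∑ j : Fin 5, iteratedFDeriv ℝ 2 P (Literature.Geometry.Riemannian.SphericalCylinderEntropy.truncL z) ![EuclideanSpace.single j (1 : ℝ), EuclideanSpace.single j (1 : ℝ)]) - iteratedFDeriv ℝ 2 P (Literature.Geometry.Riemannian.SphericalCylinderEntropy.truncL z) ![Literature.Geometry.Riemannian.SphericalCylinderEntropy.truncL z, Literature.Geometry.Riemannian.SphericalCylinderEntropy.truncL z] - 4 * fderiv ℝ P (Literature.Geometry.Riemannian.SphericalCylinderEntropy.truncL z) (Literature.Geometry.Riemannian.SphericalCylinderEntropy.truncL z)) ∂μ = 0) → ∀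 Φ : ℝ → ℝ, ContDiff ℝ 2 Φ → ∀ g : EuclideanSpace ℝ (Fin 5) → ℝ, Continuous g → ∀ t₁ t₂ : ℝ, 0 < t₁ → 0 < t₂ → (∫ z, Φ (z 5) * (∫ y in Metric.sphere (0 : EuclideanSpace ℝ (Fin 5)) 1, Literature.Geometry.Riemannian.SphericalCylinderEntropy.zonal t₁ (∑ i : Fin 5, Literature.Geometry.Riemannian.SphericalCylinderEntropy.truncL z i * y i) * g y ∂(μH[4] : Measure (EuclideanSpace ℝ (Fin 5)))) ∂μ) = ∫ z, Φ (z 5) * (∫ y in Metric.sphere (0 : EuclideanSpace ℝ (Fin 5)) 1, Literature.Geometry.Riemannian.SphericalCylinderEntropy.zonal t₂ (∑ i : Fin 5, Literature.Geometry.Riemannian.SphericalCylinderEntropy.truncL z i * y i) * g y ∂(μH[4] : Measure (EuclideanSpace ℝ (Fin 5)))) ∂μ :=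
  fun _ μ _ hsupp hH _ hΦ _ hg _ _ h₁ h₂ => flow_eq_flow μ hsupp hH hΦ hg h₁ h₂

end Summit.SmoothPoincare4.SmoothPoincare4.Cruxes.CylinderRungTwo.KillingFlux

end
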